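import Summits.HodgeConjecture.HodgeConjecture.Cruxes.BlochSeedDiscOne.RingTwoMassLaw

/-!
# PortHallPriceList — what the door-1 row PortHall₈ (`HallPlusUp D 8`) actually buys, shell by shell (ROW-α2 input, R19.832 (D3))

`line stmt-HodgeConjecture-18881 Cruxes/BlochSeedDiscOne/Lines/birth.lean 814a6a70c14e831a stub_rung_pad4_seedAt`
(plan-lens-HodgeAV-dual g21, 2026-08-31; evidence-level kernel bookkeeping in the LETTER MODEL of the door problem.  KERNEL STATEMENTS ONLY —
no `sorry`, no new axiom, no `instance`, no `notation`, no `decide`, no new predicate.  **Nothing here is proved toward HC ∕ HC_CM ∕ HC_AV ∕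
№4 ∕ 26512 ∕ 18881 ∕ H2.**  Letters ≠ sheaves ≠ SEED.)

ROW-α2 (director R19.832 (D3)) asks whether PortHall₈ — the surplus-8 Hall row `RuleDPlate.HallPlusUp D 8`, rigorous only on four-ample complete
blocks (`HallPlusAmpleUp`), an expected-dimension count on legged blocks — is a THEOREM or has a COUNTEREXAMPLE for split-block seeds.  This file
prices the answer in advance: for each closed shell of the letter-model statement of record it records, kernel-exactly, which instance of the
row the closure consumes and what survives if the row is replaced by a weaker rank floor (`HallUp` ⇒ `0 ≤ rank`; the Chern floor `4 ≤ rank`,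
i.e. `c₄(𝓔) ≠ 0 ⇒ rk 𝓔 ≥ 4`, Hall-free; or any `k ≤ rank`).

## §1 SHELL 2 IS HALL-FREE.  The tree's ring-2 closure `RingTwoMassLaw.ClassLaw.ring2_door_shut ∕ sPlus_ring2` carries `HallPlusUp D 8` as a
hypothesis but consumes it only through `Σ_P m ≤ 50 (< 60)` inside `door_law` (D-shape vanishing `m_P(H,u,u,D) = 0`: `48 ∣ m_P(H,u,u,D) = 4·m_P(H,H,D,D)`
and `m_P(H,u,u,D) + m_P(H,H,D,D) ≤ Σ_P m`, so any `Σ_P m ≤ 59` does), while the cube covering needs only `Σ_N m ≤ 74` (`7·64 ≤ 6·Σ_N m`).  Hence: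
* `door_law_of_pmass_le_59`      — the door law from `Σ_P m ≤ 59` alone (no Hall row, no budget);
* `ring2_door_shut14_of_rankFloor`, `ring2_door_shut_of_rankFloor` — **`copies + rank ≥ 117` for every charged ring-2 design closed under RULE D with
  `Disj`, (A1) and the rank floor `−1 ≤ rank`** (every height); `nmass_ge_59_of_rankFloor`;
* `sPlus_ring2_of_rankFloor ∕ _of_rank_nonneg ∕ _of_hallUp ∕ _of_chernFloor` — the `Ring2` case of the budget statement for any `σ ≥ 28·copies`
  WITHOUT PortHall₈ (from `−1 ≤ rank`, `0 ≤ rank`, `HallUp`, or `4 ≤ rank`).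
PRICE OF ¬PortHall₈ AT SHELL 2: **zero.**

## §2 SHELL 3 CONSUMES PortHall₈ EXACTLY AS `rank ≥ 8`, WITH MARGIN ONE.  The plate `ShellThreeClosed.shell3_empty_of_binders` is the Hall-free,
budget-free floor `pmass_ge_51_of_binders` (`Σ_P m ≥ 51`) against the cap `pmass_le_fifty` (`Σ_P m ≤ 50` ⇐ `Σ_N m ≤ 58` ∧ `rank ≥ 8`).  Here:
* `pmass_le_of_rankFloor`     — under the budget clause and ANY rank floor `k ≤ rank`: `Σ_P m ≤ 58 − k` (so cap 50 ⟺ k = 8);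
* `shell3_closed_of_rank8`     — the floor `51 ≤ Σ_P m` (= `ShellThreeClosed.pmass_ge_51_of_binders`, taken as a hypothesis so that this file
  does not import the shell-3 modules) closes against ANY source of `8 ≤ rank` (PortHall₈ is needed only through its top instance);
* `window_of_cap54` and `shell3_window_of_chernFloor` — with the Chern floor `4 ≤ rank` only, what is LEFT of shell 3 is the window
  **`51 ≤ Σ_P m ≤ 54`, `24 ≤ S ≤ 28`** (`S = Σ_P m·ρ_h`, `HF` = hub-free P mass; the rows (P1) `9S + 8·HF ≤ 8·Σ_P m`, (P2) `S ≥ 24`,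
  (P3) `16S ≤ (S − 8)·HF` of the plate are the hypotheses `h9`, `h24`, `h16`, exactly as `ShellThreeClosed.fiftyone_le` consumes them);
* `point_of_cap51` and `shell3_point_of_rank7` — with `7 ≤ rank` the residue is the single point **`S = 24`, `HF = 24`, `Σ_P m = 51`**;
  `shell3_window_of_rank6` ∕ `_rank5`: `S ≤ 25` ∕ `S ≤ 26`.
PRICE OF ¬PortHall₈ AT SHELL 3: the plate reopens in the stated window (and the machine binders (B), (Bu), (M2), certified under the caps
`Σ_N m ≤ 58`, `Σ_P m ≤ 50` of R19.718, would have to be re-certified at `Σ_P m ≤ 58 − k`).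

## §3 SHELL 4 (not kernel; for the record).  The closure sentence R19.823 is an exact-ℚ LP floor for the forced P-mass **against the cap 50**:
ROAD C ∕ D′ floor 51.03 (margin 1.03 — survives cap 51 = `rank ≥ 7`, dies at cap 52), ROAD D floors 58.30 ∕ 68.58 (DM rows, v4.4 currency) —
survive every cap ≤ 58 but live on worlds folded under the caps (58, 50, 108).  PRICE OF ¬PortHall₈ AT SHELL 4: every world and certificate is to be
re-folded at the new P-cap; only ROAD D's LP margins are cap-robust on paper.

Imports `RingTwoMassLaw` only (hence `RuleDPlate`); the shell-3 rows enter §2 as displayed hypotheses (instantiate with `BoxCap.pmass_ge_24`,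
`BoxCap.sixteen_pmass_le`, `ShellThreeFloorB.nine_negE_add_hubfreeMass_le` rewritten by `ShellThreeClosed.hubfreeMass_eq ∕ negE_eq_pmass`, i.e. the
three `have`s of `ShellThreeClosed.pmass_ge_51_of_binders`).  No statement of the tree is modified.
-/

set_option linter.dupNamespace false
set_option autoImplicit false

namespace Summit.HodgeConjecture.HodgeConjecture.Cruxes.BlochSeedDiscOne.PortHallPriceList

open Summit.HodgeConjecture.HodgeConjecture.Cruxes.BlochSeedDiscOne.DepthBoundA4
open Summit.HodgeConjecture.HodgeConjecture.Cruxes.BlochSeedDiscOne.HeightTower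
open Summit.HodgeConjecture.HodgeConjecture.Cruxes.BlochSeedDiscOne.LeggedFloor (RuleD Disj)
open Summit.HodgeConjecture.HodgeConjecture.Cruxes.BlochSeedDiscOne.HallB136 (HallUp sumP_le_sumN_of_hallUp)
open Summit.HodgeConjecture.HodgeConjecture.Cruxes.BlochSeedDiscOne.RuleDPlate
  (HallPlusUp BudgetClause hallUp_of_hallPlusUp eight_le_rank_of_hallPlusUp)
open Summit.HodgeConjecture.HodgeConjecture.Cruxes.BlochSeedDiscOne.RingTwoMassLaw
open Summit.HodgeConjecture.HodgeConjecture.Cruxes.BlochSeedDiscOne.RingTwoMassLaw.CI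
open Summit.HodgeConjecture.HodgeConjecture.Cruxes.BlochSeedDiscOne.RingTwoMassLaw.ClassLaw

/-! ## §1 Shell 2 is Hall-free -/

/-- **THE DOOR LAW FROM `Σ_P m ≤ 59` ALONE** (height 14; no Hall row, no budget): the D-shapes vanish, `32 ∣ Re μ`, `32 ∣ Im μ`, and
`m_N(u⁴) = m_P(u⁴) + 2·m_P(A-hooks)`. -/
theorem door_law_of_pmass_le_59 {D : Design} (hD : D.OnAlphabet 14) (hR : Ring2 D) (hdisj : Disj D) (hrule : RuleD D) (h1 : D.A1)
    (hP : Pmass D ≤ 59) :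
    mPHuuD D = 0 ∧ mPHHDD D = 0 ∧ (32 : ℤ) ∣ D.mu.re ∧ (32 : ℤ) ∣ D.mu.im ∧ massU4 D = mPU4 D + 2 * mPA D := by
  obtain ⟨h48, h12, hre, him⟩ := lattice_law hD hR hdisj hrule h1
  have h4 := huuD_law hD hR hdisj hrule h1
  have hdm := dmass_le_pmass D
  have hu0 := mPHuuD_nonneg D
  have hd0 := mPHHDD_nonneg D
  have hHuuD : mPHuuD D = 0 := by omega
  have hHHDD : mPHHDD D = 0 := by omega
  have h32re : (32 : ℤ) ∣ D.mu.re := by omega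
  have h32im : (32 : ℤ) ∣ D.mu.im := by omega
  refine ⟨hHuuD, hHHDD, h32re, h32im, ?_⟩
  have h6 := six_E hD hR hdisj hrule h1
  rw [E_room hD hR hdisj hrule, mPB_eq_zero hD hR hdisj hrule h1] at h6
  omega

/-- **RING-2 DOOR SHUT FROM THE RANK FLOOR `−1 ≤ rank` (height 14)**: no charged ring-2 design on the height-14 alphabet, closed under RULE D with
`Disj` and (A1)-clean, with `−1 ≤ rank`, satisfies `copies + rank ≤ 116`.  (Verbatim the cube covering of `ring2_door_shut14`; the only change is
that `Σ_P m ≤ 59` is read off `Σ_N m ≤ 58` and the rank floor instead of PortHall₈.) -/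
theorem ring2_door_shut14_of_rankFloor {D : Design} (hD : D.OnAlphabet 14) (hR : Ring2 D) (hdisj : Disj D) (hrule : RuleD D)
    (h1 : D.A1) (hμ : D.mu ≠ 0) (hrk : -1 ≤ D.rank) (hdoor : (D.copies : ℤ) + D.rank ≤ 116) : False := by
  have h2N := budget_eq_two_Nmass D
  have hre' := rank_eq D
  have hN58 : Nmass D ≤ 58 := by omega
  have hP59 : Pmass D ≤ 59 := by omega
  obtain ⟨-, -, h32re, h32im, hU⟩ := door_law_of_pmass_le_59 hD hR hdisj hrule h1 hP59
  have hE : E 14 D = 0 := by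
    rw [E_room hD hR hdisj hrule, hU, mPB_eq_zero hD hR hdisj hrule h1]; ring
  have hA := a1e_of_a1 D h1
  obtain ⟨e0, e1, e2, e3⟩ := re_class D.mu
  have hne : D.mu.re ≠ 0 ∨ D.mu.im ≠ 0 := by
    by_contra hc
    push Not at hc
    exact hμ (Zsqrtd.ext hc.1 hc.2)
  obtain ⟨s, hs⟩ : ∃ s : Fin 4, 32 ≤ -(zI ^ (s.val) * D.mu).re := by
    rcases hne with h | h
    · rcases le_or_gt 0 D.mu.re with hp | hn
      · exact ⟨2, by rw [show (2 : Fin 4).val = 2 from rfl, e2]; omega⟩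
      · exact ⟨0, by rw [show (0 : Fin 4).val = 0 from rfl, e0]; omega⟩
    · rcases le_or_gt 0 D.mu.im with hp | hn
      · exact ⟨1, by rw [show (1 : Fin 4).val = 1 from rfl, e1]; omega⟩
      · exact ⟨3, by rw [show (3 : Fin 4).val = 3 from rfl, e3]; omega⟩
  have hcubes : ∀ k ∈ bases s, ∃ q, inCubeB k q = true ∧ 7 ≤ nAt q D := fun k hk => by
    apply heavy_point hD hR hdisj hrule h1 k
    have hc := CS_of_class hA hE k s (bases_class s k hk)
    linarith
  have h448 := sum_cover D (bases s) hcubes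
  rw [bases_length] at h448
  have h6 : ∑ q : K4, (coverCount (bases s) q : ℤ) * nAt q D ≤ 6 * ∑ q : K4, nAt q D := by
    rw [Finset.mul_sum]
    exact Finset.sum_le_sum fun q _ =>
      mul_le_mul_of_nonneg_right (by exact_mod_cast cover_le_six s q) (nAt_nonneg q D)
  have hsum := sum_nAt_le_massU4 D
  have hm := massU4_le_Nmass D
  push_cast at h448
  linarith

/-- **RING-2 DOOR SHUT FROM THE RANK FLOOR, EVERY HEIGHT: `copies + rank ≥ 117`.** -/
theorem ring2_door_shut_of_rankFloor {h : ℤ} {D : Design} (hD : D.OnAlphabet h) (hR : Ring2 D) (hdisj : Disj D) (hrule : RuleD D)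
    (h1 : D.A1) (hμ : D.mu ≠ 0) (hrk : -1 ≤ D.rank) : 116 < (D.copies : ℤ) + D.rank := by
  by_contra hle
  push Not at hle
  exact ring2_door_shut14_of_rankFloor (onAlphabet14_of_shift hD hR) (ring2_shift (14 - h) hR) (disj_shift _ hdisj)
    (ruleD_shift _ hrule) (a1_shiftD _ D h1) (by rw [mu_shiftD]; exact hμ) (by rw [rank_shift]; exact hrk)
    (by rw [copies_shift, rank_shift]; exact hle)

/-- the same as the N-mass floor `Σ_N m ≥ 59`. -/
theorem nmass_ge_59_of_rankFloor {h : ℤ} {D : Design} (hD : D.OnAlphabet h) (hR : Ring2 D) (hdisj : Disj D) (hrule : RuleD D)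
    (h1 : D.A1) (hμ : D.mu ≠ 0) (hrk : -1 ≤ D.rank) : 59 ≤ Nmass D := by
  have := ring2_door_shut_of_rankFloor hD hR hdisj hrule h1 hμ hrk
  rw [budget_eq_two_Nmass] at this
  omega

/-- **THE `Ring2` CASE OF THE BUDGET STATEMENT WITHOUT ANY HALL ROW**: for every `σ ≥ 28·copies`, the v4.2 budget clause `σ(D) + 28(r − 4) ≤ 3136`
is violated by every charged ring-2 design closed under RULE D with `Disj`, (A1) and `−1 ≤ rank`. -/
theorem sPlus_ring2_of_rankFloor {h : ℤ} {D : Design} (σ : Design → ℤ) (hσ : 28 * (D.copies : ℤ) ≤ σ D) (hD : D.OnAlphabet h)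
    (hR : Ring2 D) (hdisj : Disj D) (h1 : D.A1) (hrule : RuleD D) (hrk : -1 ≤ D.rank) (hμ : D.mu ≠ 0)
    (hb : BudgetClause σ 0 D) : False := by
  have := ring2_door_shut_of_rankFloor hD hR hdisj hrule h1 hμ hrk
  unfold RuleDPlate.BudgetClause at hb
  omega

/-- … from `0 ≤ rank` (the rank of an honest sheaf). -/
theorem sPlus_ring2_of_rank_nonneg {h : ℤ} {D : Design} (σ : Design → ℤ) (hσ : 28 * (D.copies : ℤ) ≤ σ D) (hD : D.OnAlphabet h)
    (hR : Ring2 D) (hdisj : Disj D) (h1 : D.A1) (hrule : RuleD D) (hrk : 0 ≤ D.rank) (hμ : D.mu ≠ 0)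
    (hb : BudgetClause σ 0 D) : False :=
  sPlus_ring2_of_rankFloor σ hσ hD hR hdisj h1 hrule (by omega) hμ hb

/-- … from the plain Hall row `HallUp` (`rank ≥ 0`), PortHall₈ dropped. -/
theorem sPlus_ring2_of_hallUp {h : ℤ} {D : Design} (σ : Design → ℤ) (hσ : 28 * (D.copies : ℤ) ≤ σ D) (hD : D.OnAlphabet h)
    (hR : Ring2 D) (hdisj : Disj D) (h1 : D.A1) (hrule : RuleD D) (hU : HallUp D) (hμ : D.mu ≠ 0)
    (hb : BudgetClause σ 0 D) : False :=
  sPlus_ring2_of_rank_nonneg σ hσ hD hR hdisj h1 hrule (rank_nonneg_of_hallUp hU) hμ hb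

/-- … from the CHERN FLOOR `4 ≤ rank` (`c₄(𝓔) ≠ 0 ⇒ rk 𝓔 ≥ 4`; Hall-free). -/
theorem sPlus_ring2_of_chernFloor {h : ℤ} {D : Design} (σ : Design → ℤ) (hσ : 28 * (D.copies : ℤ) ≤ σ D) (hD : D.OnAlphabet h)
    (hR : Ring2 D) (hdisj : Disj D) (h1 : D.A1) (hrule : RuleD D) (h4 : 4 ≤ D.rank) (hμ : D.mu ≠ 0)
    (hb : BudgetClause σ 0 D) : False :=
  sPlus_ring2_of_rankFloor σ hσ hD hR hdisj h1 hrule (by omega) hμ hb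

/-! ## §2 Shell 3 consumes PortHall₈ exactly as `rank ≥ 8`, with margin one -/

/-- **the P-cap from a rank floor**: under the budget clause of any `σ ≥ 28·copies` (`copies + rank ≤ 116`, i.e. `Σ_N m ≤ 58`) and `k ≤ rank`:
`Σ_P m ≤ 58 − k`.  (`k = 8` is `ShellThreeClosed.pmass_le_fifty`.) -/
theorem pmass_le_of_rankFloor (σ : Design → ℤ) {D : Design} (hσ : 28 * (D.copies : ℤ) ≤ σ D) (hb : BudgetClause σ 0 D)
    {k : ℤ} (hk : k ≤ D.rank) : (((D.P.map Prod.snd).sum : ℕ) : ℤ) ≤ 58 - k := by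
  have h116 : (D.copies : ℤ) + D.rank ≤ 116 := by
    unfold BudgetClause at hb
    omega
  have h2N := budget_eq_two_Nmass D
  have hre' := rank_eq D
  have hP : Pmass D ≤ 58 - k := by omega
  exact hP

/-- **(P4) of the plate, restated** (`ShellThreeClosed.fiftyone_le`, same proof): rows (P2) `S ≥ 24`, (P1) `9S + 8·HF ≤ 8M`,
(P3) `16S ≤ (S − 8)·HF` force `M ≥ 51`. -/
theorem fiftyone_le {S HF M : ℤ} (h24 : 24 ≤ S) (h9 : 9 * S + 8 * HF ≤ 8 * M) (h16 : 16 * S ≤ (S - 8) * HF) :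
    51 ≤ M := by
  by_contra hlt
  push Not at hlt
  have hA : (S - 8) * (8 * HF) ≤ (S - 8) * (400 - 9 * S) :=
    mul_le_mul_of_nonneg_left (by linarith) (by linarith)
  nlinarith [mul_nonneg (show (0 : ℤ) ≤ S - 24 by linarith) (show (0 : ℤ) ≤ 9 * S - 128 by linarith)]

/-- **the shell-3 floor closes against ANY source of `8 ≤ rank`** (PortHall₈'s top instance `eight_le_rank_of_hallPlusUp` is one; the plate needs
nothing else of the row): floor `51 ≤ Σ_P m` (`ShellThreeClosed.pmass_ge_51_of_binders`) + budget + `8 ≤ rank` ⇒ ⊥. -/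
theorem shell3_closed_of_rank8 (σ : Design → ℤ) {D : Design} (hσ : 28 * (D.copies : ℤ) ≤ σ D) (hb : BudgetClause σ 0 D)
    (h51 : 51 ≤ (((D.P.map Prod.snd).sum : ℕ) : ℤ)) (h8 : 8 ≤ D.rank) : False := by
  have h50 := pmass_le_of_rankFloor σ hσ hb h8
  omega

/-- … and the tree's PortHall₈ form is the `k = 8` instance (empty P side excluded by the floor itself). -/
theorem shell3_closed_of_portHall (σ : Design → ℤ) {D : Design} (hσ : 28 * (D.copies : ℤ) ≤ σ D) (hb : BudgetClause σ 0 D)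
    (h51 : 51 ≤ (((D.P.map Prod.snd).sum : ℕ) : ℤ)) (hp : HallPlusUp D 8) : False := by
  by_cases hpos : 0 < (D.P.map Prod.snd).sum
  · exact shell3_closed_of_rank8 σ hσ hb h51 (eight_le_rank_of_hallPlusUp D hp hpos)
  · omega

/-- **margin one**: with `7 ≤ rank` the cap is `51` and the floor `51` does NOT close by counting alone. -/
theorem pmass_eq_51_of_rank7 (σ : Design → ℤ) {D : Design} (hσ : 28 * (D.copies : ℤ) ≤ σ D) (hb : BudgetClause σ 0 D)
    (h51 : 51 ≤ (((D.P.map Prod.snd).sum : ℕ) : ℤ)) (h7 : 7 ≤ D.rank) : (((D.P.map Prod.snd).sum : ℕ) : ℤ) = 51 := by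
  have h := pmass_le_of_rankFloor σ hσ hb h7
  omega

/-- **(P4) at cap 54**: `S ≥ 24`, `9S + 8·HF ≤ 8M`, `16S ≤ (S − 8)·HF`, `M ≤ 54` force `S ≤ 28`
(`128·S ≤ (S − 8)(432 − 9S)`, i.e. `9S² − 376S + 3456 ≤ 0`, and `9S² − 376S + 3456 = (S − 29)(9S − 115) + 121`). -/
theorem window_of_cap54 {S HF M : ℤ} (h9 : 9 * S + 8 * HF ≤ 8 * M) (h16 : 16 * S ≤ (S - 8) * HF)
    (hM : M ≤ 54) : S ≤ 28 := by
  by_contra hlt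
  push Not at hlt
  have hA : (S - 8) * (8 * HF) ≤ (S - 8) * (432 - 9 * S) :=
    mul_le_mul_of_nonneg_left (by linarith) (by linarith)
  nlinarith [mul_nonneg (show (0 : ℤ) ≤ S - 29 by linarith) (show (0 : ℤ) ≤ 9 * S - 115 by linarith)]

/-- **(P4) at cap 51**: the same with `M ≤ 51` forces the single point `S = 24`, `HF = 24`, `M = 51`
(`9S² − 352S + 3264 = (S − 24)(9S − 136) ≤ 0`). -/
theorem point_of_cap51 {S HF M : ℤ} (h24 : 24 ≤ S) (h9 : 9 * S + 8 * HF ≤ 8 * M) (h16 : 16 * S ≤ (S - 8) * HF)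
    (hM : M ≤ 51) : S = 24 ∧ HF = 24 ∧ M = 51 := by
  have hS : S ≤ 24 := by
    by_contra hlt
    push Not at hlt
    have hA : (S - 8) * (8 * HF) ≤ (S - 8) * (408 - 9 * S) :=
      mul_le_mul_of_nonneg_left (by linarith) (by linarith)
    nlinarith [mul_nonneg (show (0 : ℤ) ≤ S - 25 by linarith) (show (0 : ℤ) ≤ 9 * S - 127 by linarith)]
  have hS24 : S = 24 := le_antisymm hS h24
  subst hS24
  refine ⟨rfl, ?_, ?_⟩ <;> omega

/-- (P4) at cap 52 ∕ 53: `S ≤ 25` ∕ `S ≤ 26`. -/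
theorem window_of_cap52 {S HF M : ℤ} (h9 : 9 * S + 8 * HF ≤ 8 * M) (h16 : 16 * S ≤ (S - 8) * HF)
    (hM : M ≤ 52) : S ≤ 25 := by
  by_contra hlt
  push Not at hlt
  have hA : (S - 8) * (8 * HF) ≤ (S - 8) * (416 - 9 * S) :=
    mul_le_mul_of_nonneg_left (by linarith) (by linarith)
  nlinarith [mul_nonneg (show (0 : ℤ) ≤ S - 26 by linarith) (show (0 : ℤ) ≤ 9 * S - 126 by linarith)]

theorem window_of_cap53 {S HF M : ℤ} (h9 : 9 * S + 8 * HF ≤ 8 * M) (h16 : 16 * S ≤ (S - 8) * HF)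
    (hM : M ≤ 53) : S ≤ 26 := by
  by_contra hlt
  push Not at hlt
  have hA : (S - 8) * (8 * HF) ≤ (S - 8) * (424 - 9 * S) :=
    mul_le_mul_of_nonneg_left (by linarith) (by linarith)
  nlinarith [mul_nonneg (show (0 : ℤ) ≤ S - 27 by linarith) (show (0 : ℤ) ≤ 9 * S - 125 by linarith)]

/-- **WHAT IS LEFT OF SHELL 3 WITH THE CHERN FLOOR ONLY** (`4 ≤ rank` in place of PortHall₈).  With `S := Σ_P m·ρ_h`, `HF :=` the hub-free
P mass and the plate's rows (P2) `h24`, (P1) `h9`, (P3) `h16` displayed as hypotheses (they are the three `have`s of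
`ShellThreeClosed.pmass_ge_51_of_binders`): the window **`51 ≤ Σ_P m ≤ 54`, `S ≤ 28`**. -/
theorem shell3_window_of_chernFloor (σ : Design → ℤ) {D : Design} (hσ : 28 * (D.copies : ℤ) ≤ σ D) (hb : BudgetClause σ 0 D)
    {S HF : ℤ} (h24 : 24 ≤ S) (h9 : 9 * S + 8 * HF ≤ 8 * (((D.P.map Prod.snd).sum : ℕ) : ℤ))
    (h16 : 16 * S ≤ (S - 8) * HF) (h4 : 4 ≤ D.rank) :
    51 ≤ (((D.P.map Prod.snd).sum : ℕ) : ℤ) ∧ (((D.P.map Prod.snd).sum : ℕ) : ℤ) ≤ 54 ∧ S ≤ 28 := by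
  have h51 := fiftyone_le h24 h9 h16
  have h54 := pmass_le_of_rankFloor σ hσ hb h4
  have h54' : (((D.P.map Prod.snd).sum : ℕ) : ℤ) ≤ 54 := by omega
  exact ⟨h51, h54', window_of_cap54 h9 h16 h54'⟩

/-- `5 ≤ rank`: `51 ≤ Σ_P m ≤ 53`, `S ≤ 26`. -/
theorem shell3_window_of_rank5 (σ : Design → ℤ) {D : Design} (hσ : 28 * (D.copies : ℤ) ≤ σ D) (hb : BudgetClause σ 0 D)
    {S HF : ℤ} (h24 : 24 ≤ S) (h9 : 9 * S + 8 * HF ≤ 8 * (((D.P.map Prod.snd).sum : ℕ) : ℤ))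
    (h16 : 16 * S ≤ (S - 8) * HF) (h5 : 5 ≤ D.rank) :
    51 ≤ (((D.P.map Prod.snd).sum : ℕ) : ℤ) ∧ (((D.P.map Prod.snd).sum : ℕ) : ℤ) ≤ 53 ∧ S ≤ 26 := by
  have h51 := fiftyone_le h24 h9 h16
  have h53 := pmass_le_of_rankFloor σ hσ hb h5
  have h53' : (((D.P.map Prod.snd).sum : ℕ) : ℤ) ≤ 53 := by omega
  exact ⟨h51, h53', window_of_cap53 h9 h16 h53'⟩

/-- `6 ≤ rank`: `51 ≤ Σ_P m ≤ 52`, `S ≤ 25`. -/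
theorem shell3_window_of_rank6 (σ : Design → ℤ) {D : Design} (hσ : 28 * (D.copies : ℤ) ≤ σ D) (hb : BudgetClause σ 0 D)
    {S HF : ℤ} (h24 : 24 ≤ S) (h9 : 9 * S + 8 * HF ≤ 8 * (((D.P.map Prod.snd).sum : ℕ) : ℤ))
    (h16 : 16 * S ≤ (S - 8) * HF) (h6 : 6 ≤ D.rank) :
    51 ≤ (((D.P.map Prod.snd).sum : ℕ) : ℤ) ∧ (((D.P.map Prod.snd).sum : ℕ) : ℤ) ≤ 52 ∧ S ≤ 25 := by
  have h51 := fiftyone_le h24 h9 h16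
  have h52 := pmass_le_of_rankFloor σ hσ hb h6
  have h52' : (((D.P.map Prod.snd).sum : ℕ) : ℤ) ≤ 52 := by omega
  exact ⟨h51, h52', window_of_cap52 h9 h16 h52'⟩

/-- **`7 ≤ rank`: THE RESIDUE IS ONE POINT** — `S = 24`, `HF = 24`, `Σ_P m = 51`. -/
theorem shell3_point_of_rank7 (σ : Design → ℤ) {D : Design} (hσ : 28 * (D.copies : ℤ) ≤ σ D) (hb : BudgetClause σ 0 D)
    {S HF : ℤ} (h24 : 24 ≤ S) (h9 : 9 * S + 8 * HF ≤ 8 * (((D.P.map Prod.snd).sum : ℕ) : ℤ))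
    (h16 : 16 * S ≤ (S - 8) * HF) (h7 : 7 ≤ D.rank) :
    S = 24 ∧ HF = 24 ∧ (((D.P.map Prod.snd).sum : ℕ) : ℤ) = 51 := by
  have h51 := pmass_le_of_rankFloor σ hσ hb h7
  exact point_of_cap51 h24 h9 h16 (by omega)

/-- **`8 ≤ rank` (PortHall₈'s top instance, or any other source): CLOSED** — the plate's (P0), now rank-floor-exact. -/
theorem shell3_closed_of_rows_rank8 (σ : Design → ℤ) {D : Design} (hσ : 28 * (D.copies : ℤ) ≤ σ D) (hb : BudgetClause σ 0 D)
    {S HF : ℤ} (h24 : 24 ≤ S) (h9 : 9 * S + 8 * HF ≤ 8 * (((D.P.map Prod.snd).sum : ℕ) : ℤ))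
    (h16 : 16 * S ≤ (S - 8) * HF) (h8 : 8 ≤ D.rank) : False :=
  shell3_closed_of_rank8 σ hσ hb (fiftyone_le h24 h9 h16) h8

end Summit.HodgeConjecture.HodgeConjecture.Cruxes.BlochSeedDiscOne.PortHallPriceList
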